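import Literature.AlgebraicGeometry.Resolution.NormalizationInNormal
import Mathlib.RingTheory.Localization.LocalizationLocalization
import Mathlib.RingTheory.RegularLocalRing.Defs

/-!
# Route `RadicialJung`, support `CleanResolves`: the stalks of the normalisation in `L`

Route `ResolutionOfSingularities/RadicialJung`, support item `CleanResolves`
(stmt-ResolutionOfSingularities-16286). The local algebra of the plan is stated for the integral
closure of the LOCAL ring `𝒪_{V,v}` in `L` (`RadicialJungCleanResolvesRegularType.lean`: at a
regular-type clean point `integralClosure 𝒪_{V,v} L` is a regular local ring). This file supplies the
scheme-level link (folklore, Liu 2002, 4.1.2): **the local ring of `Y^L = normalizationIn Y L` at a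
point `y'` over `y` is the localisation of `integralClosure 𝒪_{Y,y} L` at a maximal ideal** — on an
affine open `U = Spec R ∋ y`, `Γ(Y^L, ι⁻¹U) ≅ integralClosure R L` (Mathlib `normalizationObjIso` and
the identification `Γ(Spec L, ξ_L⁻¹U) ≅ L`), the stalk at `y'` is its localisation at the prime `𝔮'`
of `y'`, `𝒪_{Y,y} = R_𝔮` with `𝔮 = 𝔮' ∩ R`, integral closure commutes with localisation (Mathlib
`IsLocalization.integralClosure`), and localising in two steps is localising at `𝔮'`
(`IsLocalization.isLocalization_isLocalization_atPrime_isLocalization`). Consequently, if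
`integralClosure 𝒪_{Y,y} L` is a (regular) local ring, it IS the stalk of `Y^L` at every point over
`y`. No finiteness of `L/K(Y)` is needed.

* `exists_ringEquiv_stalk_normalizationIn` — `𝒪_{Y^L,y'} ≃ (integralClosure 𝒪_{Y,y} L)_P`, `P`
  maximal;
* `nonempty_ringEquiv_stalk_normalizationIn_of_isLocalRing` — `≃ integralClosure 𝒪_{Y,y} L` when
  that ring is local;
* `isRegularLocalRing_stalk_normalizationIn` — regular when that ring is regular local.
-/

noncomputable section

set_option linter.dupNamespace false -- mandated namespace of this single-conjunct summit

open CategoryTheory AlgebraicGeometry TopologicalSpace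
open Literature.AlgebraicGeometry.Resolution

namespace Summit.ResolutionOfSingularities.ResolutionOfSingularities.Theorems.RadicialJung.CleanResolves

universe u

variable (Y : Scheme.{u}) [IsIntegral Y] (L : Type u) [Field L] [Algebra Y.functionField L]

/-- **The local rings of `Y^L` are localisations of the integral closures of the local rings of
`Y`.** For a point `y'` of `Y^L = normalizationIn Y L` over `y ∈ Y`, and `L` viewed as an
`𝒪_{Y,y}`-algebra through `K(Y)`, there is a maximal ideal `P` of `integralClosure 𝒪_{Y,y} L` with
`𝒪_{Y^L,y'} ≅ (integralClosure 𝒪_{Y,y} L)_P`. [cite: Liu2002, Def. 4.1.24, p. 155] -/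
theorem exists_ringEquiv_stalk_normalizationIn (y' : normalizationIn Y L)
    [Algebra (Y.presheaf.stalk (normalizationInι Y L y')) L]
    [IsScalarTower (Y.presheaf.stalk (normalizationInι Y L y')) Y.functionField L] :
    ∃ (P : Ideal (integralClosure (Y.presheaf.stalk (normalizationInι Y L y')) L))
      (_ : P.IsPrime), P.IsMaximal ∧
      Nonempty ((normalizationIn Y L).presheaf.stalk y' ≃+* Localization.AtPrime P) := by
  -- an affine open neighbourhood `U = Spec R` of `y = ι y'`
  obtain ⟨_, ⟨U, hU, rfl⟩, hyU, -⟩ := Y.isBasis_affineOpens.exists_subset_of_mem_open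
    (Set.mem_univ (normalizationInι Y L y')) isOpen_univ
  haveI : Nonempty U := ⟨⟨_, hyU⟩⟩
  have hU' : (U : Set Y).Nonempty := ⟨_, hyU⟩
  -- the algebras `R → Γ(Spec L, ξ⁻¹U)` and `R → K(Y) → L`
  letI algS := ((fromSpecExtension Y L).app U).hom.toAlgebra
  letI algL : Algebra Γ(Y, U) L :=
    ((algebraMap Y.functionField L).comp (Y.germToFunctionField U).hom).toAlgebra
  haveI : IsScalarTower Γ(Y, U) Y.functionField L :=
    IsScalarTower.of_algebraMap_eq (R := Γ(Y, U)) (S := Y.functionField) (A := L) fun a => rfl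
  -- `L ≅ Γ(Spec L, ξ⁻¹U)` over `R`, and the induced isomorphism of integral closures
  let e : L ≃ₐ[Γ(Y, U)] Γ(Spec (.of L), fromSpecExtension Y L ⁻¹ᵁ U) :=
    { (extensionIsoSections (X := Y) (L := L) hU').commRingCatIsoToRingEquiv with
      commutes' := fun a => (fromSpecExtension_app_apply (X := Y) (L := L) hU' a).symm }
  let eC : integralClosure Γ(Y, U) L ≃ₐ[Γ(Y, U)]
      integralClosure Γ(Y, U) Γ(Spec (.of L), fromSpecExtension Y L ⁻¹ᵁ U) :=
    ((integralClosure Γ(Y, U) L).equivMapOfInjective e.toAlgHom e.injective).trans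
      (Subalgebra.equivOfEq _ _ (integralClosure_map_algEquiv e))
  -- `B = Γ(Y^L, ι⁻¹U) ≅ integralClosure R L =: C`, compatibly with `R`
  let eB : Γ(normalizationIn Y L, normalizationInι Y L ⁻¹ᵁ U) ≃+* integralClosure Γ(Y, U) L :=
    ((fromSpecExtension Y L).normalizationObjIso hU).commRingCatIsoToRingEquiv.trans
      eC.symm.toRingEquiv
  have heB : ∀ r : Γ(Y, U), eB ((normalizationInι Y L).app U r) =
      algebraMap Γ(Y, U) (integralClosure Γ(Y, U) L) r := by
    intro r
    have h1 : (normalizationInι Y L).app U r = ((fromSpecExtension Y L).normalizationObjIso hU).inv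
        (algebraMap Γ(Y, U) (integralClosure Γ(Y, U)
          Γ(Spec (.of L), fromSpecExtension Y L ⁻¹ᵁ U)) r) := by
      have := (fromSpecExtension Y L).fromNormalization_app hU
      change (fromSpecExtension Y L).fromNormalization.app U r = _
      rw [this]
      rfl
    rw [h1]
    change eC.symm (((fromSpecExtension Y L).normalizationObjIso hU).hom
      (((fromSpecExtension Y L).normalizationObjIso hU).inv _)) = _
    rw [← CommRingCat.comp_apply, Iso.inv_hom_id, CommRingCat.id_apply]
    exact eC.symm.commutes r
  -- the primes `𝔮` of `y` in `R` and `𝔮'` of `y'` in `B`, `𝔮' ∩ R = 𝔮`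
  have hV : IsAffineOpen (normalizationInι Y L ⁻¹ᵁ U) := hU.preimage (normalizationInι Y L)
  have hyV : y' ∈ normalizationInι Y L ⁻¹ᵁ U := hyU
  obtain ⟨q, hq⟩ : ∃ q : PrimeSpectrum Γ(Y, U), q = hU.primeIdealOf ⟨_, hyU⟩ := ⟨_, rfl⟩
  obtain ⟨q', hq'⟩ : ∃ q' : PrimeSpectrum Γ(normalizationIn Y L, normalizationInι Y L ⁻¹ᵁ U),
      q' = hV.primeIdealOf ⟨y', hyV⟩ := ⟨_, rfl⟩
  have hqq' : q'.asIdeal.comap ((normalizationInι Y L).app U).hom = q.asIdeal := by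
    have h := IsAffineOpen.comap_primeIdealOf_appLE U hU (normalizationInι Y L ⁻¹ᵁ U) hV
      le_rfl hyV
    rw [← Scheme.Hom.app_eq_appLE, ← hq', ← hq] at h
    exact congrArg PrimeSpectrum.asIdeal h
  -- the prime `Q` of `C = integralClosure R L` corresponding to `y'`
  obtain ⟨Q, hQdef⟩ : ∃ Q : Ideal (integralClosure Γ(Y, U) L),
      Q = q'.asIdeal.comap eB.symm.toRingHom := ⟨_, rfl⟩
  haveI hQ : Q.IsPrime := by rw [hQdef]; exact Ideal.comap_isPrime _ _
  have hmemQ : ∀ x, x ∈ Q ↔ eB.symm x ∈ q'.asIdeal := fun x => by rw [hQdef]; rfl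
  have hQq : Q.comap (algebraMap Γ(Y, U) (integralClosure Γ(Y, U) L)) = q.asIdeal := by
    ext r
    constructor
    · intro hr
      have h1 : eB.symm (algebraMap _ _ r) ∈ q'.asIdeal := (hmemQ _).mp (Ideal.mem_comap.mp hr)
      rw [← heB r, RingEquiv.symm_apply_apply] at h1
      have h2 : r ∈ q'.asIdeal.comap ((normalizationInι Y L).app U).hom := Ideal.mem_comap.mpr h1
      rwa [hqq'] at h2
    · intro hr
      rw [← hqq'] at hr
      have h1 := Ideal.mem_comap.mp hr
      refine Ideal.mem_comap.mpr ((hmemQ _).mpr ?_)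
      rw [← heB r, RingEquiv.symm_apply_apply]
      exact h1
  -- `O = 𝒪_{Y,y} = R_𝔮`, and `R → O → L` is `R → L`
  letI algO := TopCat.Presheaf.algebra_section_stalk Y.presheaf (⟨_, hyU⟩ : U)
  haveI hO : IsLocalization.AtPrime (Y.presheaf.stalk (normalizationInι Y L y')) q.asIdeal := by
    rw [hq]; exact hU.isLocalization_stalk ⟨_, hyU⟩
  haveI hT := functionField_isScalarTower Y U (⟨_, hyU⟩ : U)
  haveI : IsScalarTower Γ(Y, U) (Y.presheaf.stalk (normalizationInι Y L y')) L := by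
    refine IsScalarTower.of_algebraMap_eq fun r => ?_
    rw [IsScalarTower.algebraMap_apply (Y.presheaf.stalk (normalizationInι Y L y'))
      Y.functionField L, ← IsScalarTower.algebraMap_apply Γ(Y, U)
      (Y.presheaf.stalk (normalizationInι Y L y')) Y.functionField]
    rfl
  -- the inclusion `C = integralClosure R L ⊆ integralClosure O L`
  let incl : integralClosure Γ(Y, U) L →+*
      integralClosure (Y.presheaf.stalk (normalizationInι Y L y')) L :=
    { toFun := fun x => ⟨(x : L), IsIntegral.tower_top
          (A := (Y.presheaf.stalk (normalizationInι Y L y') : Type u))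
          (show IsIntegral Γ(Y, U) (x : L) from x.2)⟩
      map_one' := rfl
      map_mul' := fun _ _ => rfl
      map_zero' := rfl
      map_add' := fun _ _ => rfl }
  letI algCC := incl.toAlgebra
  haveI : IsScalarTower (integralClosure Γ(Y, U) L)
      (integralClosure (Y.presheaf.stalk (normalizationInι Y L y')) L) L :=
    IsScalarTower.of_algebraMap_eq fun x => rfl
  haveI : IsScalarTower Γ(Y, U) (integralClosure Γ(Y, U) L)
      (integralClosure (Y.presheaf.stalk (normalizationInι Y L y')) L) :=
    IsScalarTower.of_algebraMap_eq fun r => Subtype.ext rfl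
  -- integral closure commutes with localisation
  have hinjRL : Function.Injective (algebraMap Γ(Y, U) L) :=
    (algebraMap Y.functionField L).injective.comp (Y.germToFunctionField_injective U)
  haveI : IsLocalization (Algebra.algebraMapSubmonoid L q.asIdeal.primeCompl) L := by
    refine IsLocalization.of_le_isUnit fun x hx => ?_
    obtain ⟨r, hr, rfl⟩ := hx
    refine (Ne.isUnit ?_ : IsUnit (algebraMap Γ(Y, U) L r))
    rw [map_ne_zero_iff _ hinjRL]
    rintro rfl
    exact hr (Ideal.zero_mem _)
  haveI hloc := IsLocalization.integralClosure (R := Γ(Y, U)) (S := L)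
    (Rf := (Y.presheaf.stalk (normalizationInι Y L y') : Type u)) (Sf := L)
    q.asIdeal.primeCompl
  -- the prime `P = Q · integralClosure O L`
  have hdisj : Disjoint ((Algebra.algebraMapSubmonoid (integralClosure Γ(Y, U) L)
      q.asIdeal.primeCompl : Set (integralClosure Γ(Y, U) L))) (Q : Set _) := by
    rw [Set.disjoint_left]
    rintro _ ⟨r, hr, rfl⟩ hrQ
    exact hr (show r ∈ q.asIdeal by rw [← hQq, Ideal.mem_comap]; exact hrQ)
  haveI hP : (Q.map (algebraMap (integralClosure Γ(Y, U) L)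
      (integralClosure (Y.presheaf.stalk (normalizationInι Y L y')) L))).IsPrime :=
    IsLocalization.isPrime_of_isPrime_disjoint _ _ Q hQ hdisj
  have hPQ : (Q.map (algebraMap (integralClosure Γ(Y, U) L)
      (integralClosure (Y.presheaf.stalk (normalizationInι Y L y')) L))).comap
        (algebraMap _ _) = Q :=
    IsLocalization.under_map_of_isPrime_disjoint _ _ hQ hdisj
  -- `(integralClosure O L)_P` is the localisation of `C` at `Q`
  have hTQ := IsLocalization.isLocalization_isLocalization_atPrime_isLocalization
    (Algebra.algebraMapSubmonoid (integralClosure Γ(Y, U) L) q.asIdeal.primeCompl)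
    (T := Localization.AtPrime (Q.map (algebraMap (integralClosure Γ(Y, U) L)
      (integralClosure (Y.presheaf.stalk (normalizationInι Y L y')) L))))
    (Q.map (algebraMap (integralClosure Γ(Y, U) L)
      (integralClosure (Y.presheaf.stalk (normalizationInι Y L y')) L)))
  have hMQ : (Ideal.comap (algebraMap (integralClosure Γ(Y, U) L)
      (integralClosure (Y.presheaf.stalk (normalizationInι Y L y')) L))
      (Q.map (algebraMap (integralClosure Γ(Y, U) L)
        (integralClosure (Y.presheaf.stalk (normalizationInι Y L y')) L)))).primeCompl =
      Q.primeCompl := by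
    ext x
    change x ∉ _ ↔ x ∉ _
    rw [hPQ]
  change IsLocalization (Ideal.primeCompl _) _ at hTQ
  rw [hMQ] at hTQ
  -- the stalk of `Y^L` at `y'` is the localisation of `B ≅ C` at `𝔮' ↦ Q`
  letI algB := TopCat.Presheaf.algebra_section_stalk (normalizationIn Y L).presheaf
    (⟨y', hyV⟩ : ↥(normalizationInι Y L ⁻¹ᵁ U))
  haveI hst : IsLocalization.AtPrime ((normalizationIn Y L).presheaf.stalk y') q'.asIdeal := by
    rw [hq']; exact hV.isLocalization_stalk ⟨y', hyV⟩
  have hst' := IsLocalization.isLocalization_of_base_ringEquiv q'.asIdeal.primeCompl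
    ((normalizationIn Y L).presheaf.stalk y') eB
  letI algCst : Algebra (integralClosure Γ(Y, U) L) ((normalizationIn Y L).presheaf.stalk y') :=
    ((algebraMap Γ(normalizationIn Y L, normalizationInι Y L ⁻¹ᵁ U)
      ((normalizationIn Y L).presheaf.stalk y')).comp eB.symm.toRingHom).toAlgebra
  have hmap : q'.asIdeal.primeCompl.map eB = Q.primeCompl := by
    ext x
    constructor
    · rintro ⟨z, hz, rfl⟩
      change eB z ∉ Q
      rw [hmemQ]
      rwa [RingEquiv.symm_apply_apply]
    · intro hx
      refine ⟨eB.symm x, ?_, eB.apply_symm_apply x⟩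
      change eB.symm x ∉ q'.asIdeal
      rwa [← hmemQ]
  rw [hmap] at hst'
  haveI : IsLocalization.AtPrime ((normalizationIn Y L).presheaf.stalk y') Q := hst'
  -- maximality of `P`: it lies over the maximal ideal of `O`
  have hPmax : (Q.map (algebraMap (integralClosure Γ(Y, U) L)
      (integralClosure (Y.presheaf.stalk (normalizationInι Y L y')) L))).IsMaximal := by
    refine Ideal.isMaximal_of_isIntegral_of_isMaximal_comap
      (R := (Y.presheaf.stalk (normalizationInι Y L y') : Type u)) _ ?_
    have hunder : ((Q.map (algebraMap (integralClosure Γ(Y, U) L)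
        (integralClosure (Y.presheaf.stalk (normalizationInι Y L y')) L))).comap
        (algebraMap (Y.presheaf.stalk (normalizationInι Y L y')) _)).comap
        (algebraMap Γ(Y, U) (Y.presheaf.stalk (normalizationInι Y L y'))) = q.asIdeal := by
      rw [Ideal.comap_comap, ← hQq]
      conv_rhs => rw [← hPQ, Ideal.comap_comap]
      congr 1
      refine RingHom.ext fun r => Subtype.ext ?_
      exact (IsScalarTower.algebraMap_apply Γ(Y, U)
        (Y.presheaf.stalk (normalizationInι Y L y')) L r).symm
    have key : (Q.map (algebraMap (integralClosure Γ(Y, U) L)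
        (integralClosure (Y.presheaf.stalk (normalizationInι Y L y')) L))).comap
        (algebraMap (Y.presheaf.stalk (normalizationInι Y L y')) _) =
        IsLocalRing.maximalIdeal (Y.presheaf.stalk (normalizationInι Y L y')) := by
      rw [← IsLocalization.map_under q.asIdeal.primeCompl
        (Y.presheaf.stalk (normalizationInι Y L y')) ((Q.map _).comap _), Ideal.under_def, hunder]
      exact IsLocalization.AtPrime.map_eq_maximalIdeal q.asIdeal _
    rw [key]
    exact IsLocalRing.maximalIdeal.isMaximal _
  exact ⟨_, hP, hPmax, ⟨(IsLocalization.algEquiv Q.primeCompl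
    ((normalizationIn Y L).presheaf.stalk y') (Localization.AtPrime (Q.map (algebraMap
      (integralClosure Γ(Y, U) L)
      (integralClosure (Y.presheaf.stalk (normalizationInι Y L y')) L))))).toRingEquiv⟩⟩

/-- **If the integral closure of `𝒪_{Y,y}` in `L` is local, it is the local ring of `Y^L` at every
point over `y`** (the localisation of a local ring at its maximal ideal is the ring itself).
[cite: Liu2002, Def. 4.1.24, p. 155] -/
theorem nonempty_ringEquiv_stalk_normalizationIn_of_isLocalRing (y' : normalizationIn Y L)
    [Algebra (Y.presheaf.stalk (normalizationInι Y L y')) L]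
    [IsScalarTower (Y.presheaf.stalk (normalizationInι Y L y')) Y.functionField L]
    [IsLocalRing (integralClosure (Y.presheaf.stalk (normalizationInι Y L y')) L)] :
    Nonempty ((normalizationIn Y L).presheaf.stalk y' ≃+*
      integralClosure (Y.presheaf.stalk (normalizationInι Y L y')) L) := by
  obtain ⟨P, hP, hPmax, ⟨e⟩⟩ := exists_ringEquiv_stalk_normalizationIn Y L y'
  have hPm : P = IsLocalRing.maximalIdeal _ := IsLocalRing.eq_maximalIdeal hPmax
  have H : P.primeCompl ≤ IsUnit.submonoid
      (integralClosure (Y.presheaf.stalk (normalizationInι Y L y')) L) := by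
    intro x hx
    have hx' : x ∉ IsLocalRing.maximalIdeal _ := hPm ▸ hx
    exact IsLocalRing.notMem_maximalIdeal.mp hx'
  exact ⟨e.trans (IsLocalization.atUnits _ P.primeCompl (S := Localization.AtPrime P)
    H).symm.toRingEquiv⟩

/-- **Regularity of `Y^L` over a point whose integral closure is a regular local ring**: if
`integralClosure 𝒪_{Y,y} L` is a regular local ring, then `𝒪_{Y^L,y'}` is a regular local ring for
every `y'` over `y`. With `RadicialJungCleanResolvesRegularType` this gives: over a REGULAR-TYPE
clean point of the model `V`, the normalisation `V^L` is regular. [folklore] -/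
theorem isRegularLocalRing_stalk_normalizationIn (y' : normalizationIn Y L)
    [Algebra (Y.presheaf.stalk (normalizationInι Y L y')) L]
    [IsScalarTower (Y.presheaf.stalk (normalizationInι Y L y')) Y.functionField L]
    [IsRegularLocalRing (integralClosure (Y.presheaf.stalk (normalizationInι Y L y')) L)] :
    IsRegularLocalRing ((normalizationIn Y L).presheaf.stalk y') := by
  obtain ⟨e⟩ := nonempty_ringEquiv_stalk_normalizationIn_of_isLocalRing Y L y'
  exact IsRegularLocalRing.of_ringEquiv e.symm

end Summit.ResolutionOfSingularities.ResolutionOfSingularities.Theorems.RadicialJung.CleanResolves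

end
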